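import Literature.Geometry.Riemannian.PeriodicTubularMap
import Literature.Geometry.Riemannian.RiemannianMetricExists
import Literature.Geometry.Riemannian.ExpMapGlobalSmooth
import HarnessLib

/-!
# A tubular map along a closed curve in an oriented 4-manifold (metric-free statement)

Topic `Literature/Geometry/Riemannian`.  The metric-free form of `PeriodicTubularMap.lean`: on an
oriented `4`-manifold `M` without boundary (Hausdorff, σ-compact, any boundaryless model with
corners on a `4`-dimensional model space), every `C^∞`, regular, `T`-periodic curve `γ`, injective
modulo `T`, has a **tubular map** `χ : ℝ × ℝ³ → M` — `T`-periodic, `χ(θ, 0) = γ θ`,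
`dχ_{(θ,0)}(c, u) = c γ'(θ) + ∑ uₐ ν_{a+1}(θ)` for a `T`-periodic `C^∞` frame `ν₀ ∥ γ', ν₁, ν₂, ν₃`
along `γ`, and, on a uniform tube `‖x‖ < r`, `C^∞` with injective differential and injective modulo
`T` (`exists_tubularMap_of_closedCurve`).  Proof: choose a `C^∞` Riemannian metric
(`exists_isRiemannian`), its Levi-Civita connection (`hasLeviCivita`,
`isLeviCivita_leviCivita_holds`, `isLocallyContMDiff_leviCivita_holds`) and apply
`exists_periodic_tubularMap`.  This is the tubular neighbourhood theorem for embedded circles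
(Hirsch, *Differential Topology* (1976), Ch. 4, §5, Thm. 5.2; Lee, *Introduction to Riemannian
Manifolds* (2018), Thm. 5.25) in the parametrised form used for the zero circles of near-symplectic
forms (`Literature/Geometry/Symplectic`).  Everything is proved; no definitions, no named facts.

## References

* M. W. Hirsch, *Differential Topology*, GTM 33 (1976), Ch. 4, §5, Thm. 5.2. [HirschDT1976]
* J. M. Lee, *Introduction to Riemannian Manifolds*, 2nd ed., GTM 176 (2018), Thm. 5.25.
  [LeeRiemannianManifolds2018]
-/

noncomputable section

open Bundle Set Filter Function Module Metric
open scoped Manifold ContDiff Topology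

namespace Literature.Geometry.Riemannian

open Literature.Geometry.Lorentzian Literature.Topology.FourManifolds

variable {E : Type*} [NormedAddCommGroup E] [NormedSpace ℝ E] [FiniteDimensional ℝ E]
  [CompleteSpace E] {H : Type*} [TopologicalSpace H] {I : ModelWithCorners ℝ E H}
  [I.Boundaryless] {M : Type*} [TopologicalSpace M] [ChartedSpace H M] [IsManifold I ∞ M]
  [T2Space M] [SigmaCompactSpace M]

/-- **Tubular map along a closed curve in an oriented `4`-manifold** (Hirsch 1976, Ch. 4
Thm. 5.2; Lee 2018, Thm. 5.25), metric-free statement: for a `C^∞`, regular, `T`-periodic curve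
`γ` (`T > 0`), injective modulo `T`, there are `χ : ℝ × ℝ³ → M`, a `T`-periodic frame `ν` along
`γ` with `C^∞` lifts, linearly independent, `ν₀ = c γ'` (`c > 0`), and `r > 0` with: `χ`
`T`-periodic, `χ(θ, 0) = γ θ`, `dχ_{(θ,0)}(c, u) = c γ'(θ) + ∑ uₐ ν_{a+1}(θ)`, and for `‖x‖ < r`:
`χ` is `C^∞` at `(θ, x)` with injective differential, and `χ(θ, x) = χ(θ', x')` forces `x = x'`,
`θ' - θ ∈ Tℤ`. [cite: HirschDT1976, Ch. 4 §5 Thm. 5.2] -/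
theorem exists_tubularMap_of_closedCurve (hE : finrank ℝ E = 4) (o : SmoothOrientation I M)
    {γ : ℝ → M} (hγ : ContMDiff 𝓘(ℝ, ℝ) I ∞ γ) {T : ℝ} (hT : 0 < T)
    (hper : ∀ t, γ (t + T) = γ t) (hvel : ∀ t, velocity I γ t ≠ 0)
    (hinjT : ∀ θ θ' : ℝ, γ θ = γ θ' → ∃ k : ℤ, θ' = θ + k * T) :
    ∃ (χ : ℝ × (Fin 3 → ℝ) → M) (ν : Fin 4 → Π t : ℝ, TangentSpace I (γ t)) (r : ℝ),
      (∀ i, ContMDiff 𝓘(ℝ, ℝ) I.tangent ∞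
        (fun t ↦ (TotalSpace.mk' E (γ t) (ν i t) : TangentBundle I M))) ∧
      (∀ i t, ν i (t + T) = ν i t) ∧
      (∀ t, LinearIndependent ℝ fun i ↦ (ν i t : E)) ∧
      (∀ t, ∃ c : ℝ, 0 < c ∧ ν 0 t = c • velocity I γ t) ∧
      0 < r ∧
      (∀ θ (x : Fin 3 → ℝ), χ (θ + T, x) = χ (θ, x)) ∧
      (∀ θ, χ (θ, 0) = γ θ) ∧
      (∀ θ (u : ℝ × (Fin 3 → ℝ)), mfderiv (𝓘(ℝ, ℝ).prod 𝓘(ℝ, Fin 3 → ℝ)) I χ (θ, 0) u =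
        u.1 • velocity I γ θ + ∑ a, u.2 a • ν a.succ θ) ∧
      (∀ q : ℝ × (Fin 3 → ℝ), ‖q.2‖ < r →
        ContMDiffAt (𝓘(ℝ, ℝ).prod 𝓘(ℝ, Fin 3 → ℝ)) I ∞ χ q ∧
        Injective (mfderiv (𝓘(ℝ, ℝ).prod 𝓘(ℝ, Fin 3 → ℝ)) I χ q)) ∧
      (∀ θ θ' (x x' : Fin 3 → ℝ), ‖x‖ < r → ‖x'‖ < r → χ (θ, x) = χ (θ', x') →
        x = x' ∧ ∃ k : ℤ, θ' = θ + k * T) := by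
  classical
  -- a smooth Riemannian metric and its Levi-Civita connection
  obtain ⟨g, hg⟩ := exists_isRiemannian (I := I) (M := M)
  haveI : Fact ((1 : ℕ∞ω) ≤ (∞ : ℕ∞ω)) := ⟨by exact_mod_cast le_top⟩
  haveI : g.HasLeviCivita := g.hasLeviCivita
  have hLC := PseudoRiemannianMetric.isLeviCivita_leviCivita_holds (g := g)
  have hreg : g.leviCivita.IsLocallyContMDiff ∞ := hLC.isLocallyContMDiff ⊤ (le_of_eq rfl)
  have hk1 : ((1 : ℕ∞) : ℕ∞ω) + 1 ≤ ((⊤ : ℕ∞) : ℕ∞ω) := by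
    rw [show ((1 : ℕ∞) : ℕ∞ω) + 1 = 2 by norm_num]
    exact WithTop.coe_le_coe.2 le_top
  haveI : CovariantDerivative.ContMDiffCovariantDerivative g.leviCivita 1 :=
    ⟨g.isLocallyContMDiff_leviCivita_holds 1 hk1 univ isOpen_univ⟩
  haveI : CovariantDerivative.ContMDiffCovariantDerivative g.leviCivita ((⊤ : ℕ∞) : ℕ∞ω) :=
    ⟨g.isLocallyContMDiff_leviCivita_holds ⊤ (le_of_eq rfl) univ isOpen_univ⟩
  obtain ⟨ν, r, hon, hsm, hν0, hνper, hr, hχper, hχ0, hdχ0, hreg', hinj⟩ :=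
    exists_periodic_tubularMap g hg hLC.2 hreg hE o hγ hT hper hvel hinjT
  refine ⟨fun q ↦ expMap g.leviCivita (γ q.1) (∑ a, q.2 a • ν a.succ q.1), ν, r, hsm, hνper,
    fun t ↦ linearIndependent_of_val_orthonormal g (hon t), fun t ↦ ?_, hr, hχper, hχ0, hdχ0,
    hreg', hinj⟩
  refine ⟨(Real.sqrt (g.val (γ t) (velocity I γ t) (velocity I γ t)))⁻¹,
    inv_pos.2 (Real.sqrt_pos.2 (hg _ _ (hvel t))), hν0 t⟩

end Literature.Geometry.Riemannian

end
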